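import Mathlib
import Summits.ValiantsHypothesis.ValiantsHypothesis.Theorems.LacunarySymmetroidMatrixDescartesTieLawDefs
import HarnessLib

/-!
# ValiantsHypothesis / LacunarySymmetroid — crux `MatrixDescartes` (stmt-ValiantsHypothesis-18050, V1), LINE (A) «product_plus_one»:
# the TIE LAW, kernel path Stage 2 — definitions for the complex-plane argument (rotations, sectors, the trinomial, `M_F`)

Objects of the §45 proof of the tie law (pen val-idea-25 g8, HOME NOTE §45; `…TieLawDefs` has `mPoly/nPoly/qPoly/tieM` and
`TieLaw.Statement`), all elementary and stated WITHOUT `Complex.arg` — every sector below is an intersection of two open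
half-planes through `0`, so that membership is a pair of sign conditions on imaginary parts:

* `rot θ = exp(iθ)`;
* `tieSector c = S′ = {x : |arg x| < π/c} = {x : 0 < Im(x·e^{iπ/c}) ∧ Im(x·e^{−iπ/c}) < 0}` (valid description for `c > 2`),
  its open exterior `tieExterior c = {x : Im(x·e^{iπ/c}) < 0 ∨ 0 < Im(x·e^{−iπ/c})}`; the complement of their union is the two
  closed boundary rays `t·e^{±iπ/c}`, `t ≥ 0`;
* `trinSector c = {ζ : 0 < arg ζ < 2π/c} = {ζ : 0 < Im ζ ∧ Im(ζ·e^{−2πi/c}) < 0}` and its open exterior `trinExterior c` — the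
  sector in which the trinomial `g = γζ^c + ζ^a − β` has exactly one root ((I5) of §45);
* `gPoly a c β γ = C γ * X^c + X^a − C β ∈ ℝ[X]` — the real trinomial `g` (`qPoly = g(ω·)·g(ω̄·)`, (I1));
* `MF a b F β γ w = Σ_{f ∈ F} w_f · n_f · ∏_{f' ∈ F ∖ {f}} q_{f'}` — `tieM` over an arbitrary finite set `F` of wells (the
  induction on the number of wells runs over `F`; `tieM a b β γ w = MF a b Finset.univ β γ w`).

HONEST FRAMING: definitions only (plus `Iff.rfl` membership lemmas); nothing here proves anything about LINE (A); no stub is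
touched; `MatrixDescartes` OPEN; `VP ≠ VNP` is NOT proved.  No named facts.
-/

set_option linter.dupNamespace false

namespace Summit.ValiantsHypothesis.ValiantsHypothesis.Theorems.LacunarySymmetroidMatrixDescartes

namespace TieLaw

open Polynomial

noncomputable section

/-- The rotation `e^{iθ}` as a complex number. -/
def rot (θ : ℝ) : ℂ := Complex.exp (θ * Complex.I)

/-- The open tie sector `S′ = {x : |arg x| < π/c}`, written as the intersection of the two open half-planes
`0 < Im(x e^{iπ/c})` and `Im(x e^{−iπ/c}) < 0` (for `c > 2`). -/
def tieSector (c : ℕ) : Set ℂ :=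
  {x | 0 < (x * rot (Real.pi / c)).im ∧ (x * rot (-(Real.pi / c))).im < 0}

/-- The open exterior of the closed tie sector: `Im(x e^{iπ/c}) < 0` or `0 < Im(x e^{−iπ/c})`. -/
def tieExterior (c : ℕ) : Set ℂ :=
  {x | (x * rot (Real.pi / c)).im < 0 ∨ 0 < (x * rot (-(Real.pi / c))).im}

/-- The open sector `{ζ : 0 < arg ζ < 2π/c}` = `{0 < Im ζ} ∩ {Im(ζ e^{−2πi/c}) < 0}` (for `c > 2`). -/
def trinSector (c : ℕ) : Set ℂ :=
  {z | 0 < z.im ∧ (z * rot (-(2 * Real.pi / c))).im < 0}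

/-- The open exterior of the closed sector `{0 ≤ arg ζ ≤ 2π/c}`: `Im ζ < 0` or `0 < Im(ζ e^{−2πi/c})`. -/
def trinExterior (c : ℕ) : Set ℂ :=
  {z | z.im < 0 ∨ 0 < (z * rot (-(2 * Real.pi / c))).im}

/-- The real trinomial `g = γ X^c + X^a − β` (`qPoly a c β γ = g(e^{iπ/c} X) · g(e^{−iπ/c} X)` by (I1)). -/
def gPoly (a c : ℕ) (β γ : ℝ) : ℝ[X] := C γ * X ^ c + X ^ a - C β

/-- `M_F = Σ_{f ∈ F} w_f · n_f · ∏_{f' ∈ F.erase f} q_{f'}` for a finite set `F` of wells `(β_f, γ_f)` with weights `w_f`,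
shape `(a, b)`, `c = a + b`: the polynomial `tieM` of `…TieLawDefs` over an arbitrary finite index set. -/
def MF {ι : Type*} [DecidableEq ι] (a b : ℕ) (F : Finset ι) (β γ w : ι → ℝ) : ℝ[X] :=
  ∑ f ∈ F, C (w f) * nPoly a b (a + b) (β f) (γ f) * ∏ f' ∈ F.erase f, qPoly a (a + b) (β f') (γ f')

end

/-- Membership in the tie sector `S′`, unfolded. -/
theorem mem_tieSector {c : ℕ} {x : ℂ} :
    x ∈ tieSector c ↔ 0 < (x * rot (Real.pi / c)).im ∧ (x * rot (-(Real.pi / c))).im < 0 := Iff.rfl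

/-- Membership in the exterior of the tie sector, unfolded. -/
theorem mem_tieExterior {c : ℕ} {x : ℂ} :
    x ∈ tieExterior c ↔ (x * rot (Real.pi / c)).im < 0 ∨ 0 < (x * rot (-(Real.pi / c))).im := Iff.rfl

/-- Membership in the trinomial sector `{0 < arg ζ < 2π/c}`, unfolded. -/
theorem mem_trinSector {c : ℕ} {z : ℂ} :
    z ∈ trinSector c ↔ 0 < z.im ∧ (z * rot (-(2 * Real.pi / c))).im < 0 := Iff.rfl

/-- Membership in the exterior of the trinomial sector, unfolded. -/
theorem mem_trinExterior {c : ℕ} {z : ℂ} :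
    z ∈ trinExterior c ↔ z.im < 0 ∨ 0 < (z * rot (-(2 * Real.pi / c))).im := Iff.rfl

/-- `tieM` is `MF` over all of `Fin T`. -/
theorem tieM_eq_MF (a b : ℕ) {T : ℕ} (β γ w : Fin T → ℝ) :
    tieM a b β γ w = MF a b Finset.univ β γ w := rfl

end TieLaw

end Summit.ValiantsHypothesis.ValiantsHypothesis.Theorems.LacunarySymmetroidMatrixDescartes
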